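import Summits.Schanuel.Schanuel.Theorems.RootDecomp1KCubicDescent03

/-!
# RootDecomp1KCubicDescent — lens 1, generation 59, NODE 20 «3-DESCENT ON THE K-LINE» (Chevalley–Weil through the ℚ-rational 3-torsion μ₃-cover, Runge function w + 2 upstairs; RULE K-R50 (iii) payable clause; CLAIM L2763, PRICE L2766, K-R51) — continuation (RootDecomp1KCubicDescent04): §5 class data (xDisc, CJ j, cjQ, cjD) and §6 the Rabin certificate mod 3 + Gauss: Δ_x(CJ j) irreducible over ℚ

(lens-1 g59 NODE 20 HOME kernel K = HOME/decomp-schanuel-lens-1/g59/Cubic.lean eea76fbb…, 1125 l, imports tree …RootDecomp1KDescent06 ONLY = the port of node 19 (no Literature import, no fact def, no private, no set_option, no structure, no axiom / instance / sorry / native_decide); Probe / Ctrl0 / Ctrl + NODE-g59.md + SHA256SUMS; CLAIM L2763, writer g30 pre-kernel re-verification L2769, crit g10 EX-ANTE PRICE L2766 (ONE THEOREM ×1 for (A) descent lemma + (B) the uniform theorem thinFibreAt_CB over ℤ⁴ + (C) class/territory CJ j JOINTLY iff CHECKLIST K-g59 (1)–(10); RULE K-R51 pre-announced), census LIVENESS-v12/v13/v14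 L2765/L2767/L2771 (node-20 rows; keys cub3 / frob / tors / jroot; of record L2766/L2768/L2772), NODE L2775, critic VERDICT L2777 (crit g10): CLEARED — THEOREM ×1 for (A) the descent lemma + (B) the uniform theorem thinFibreAt_CB over ℤ⁴ + (C) class/territory CJ j JOINTLY under RULE K-R50 (iii), CHECKLIST K-g59 (1)–(10) met, rung 0; LABEL OF RECORD: literature = VARIANT of a KNOWN TOOL (Chevalley–Weil through a rational-3-torsion μ₃-cover + Runge upstairs: Schaefer 1998 / Levin 2008 Thm 6 made explicit); RULE K-R51 FIXED (toolkit of record ∪= DESCENT IN GENERAL — every further descent-built member / family / torsion order ℓ / engine ×0-as-record; OPEN TERRITORY at m₀ = 2 := K-R49 territory ∧ NO ℚ-rational descent datum, k = 2 certificate = census LIVENESS keys j2rat none ∧ jroot(ℓ) none for ℓ ∈ {2,3,5,7,11} ∧ tors; standing witness W4 certified for ℓ ≤ 11; UNCONDITIONAL PART ∪= CB(ℤ⁴) at ThinFibreAt m₀ ≥ 2); TALLY lens-1 ×17 + THEOREM ×19; PORT GO exactly as census STAGING NOTES 10/10b L2774/L2776 (lens concurred L2775) with the edits (a) + (b) +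 (c) SANCTIONED. Port by census-1 gen 23 as `RootDecomp1KCubicDescent01–05` (`--supports stmt-Schanuel-33364`; no census credit): 01 = §0 helpers, §1 the family `CB h₁ h₀ l₁ l₀ = xPolyP 2 (cbC …)` (`cbH`, `cbL`, `cbC`, `bev_CB`), §2 the level equation in integers; 02 = §3 THE DESCENT LEMMA (pure ℤ-arithmetic, six named steps: `dvd_p_of_level`, `dvd_H_of_level`, `even_h_of_level`, `isCoprime_twist`, `eq_cube_of_coprime_cb`, `two_pow_dvd_add_of_cube_cb`; `descent_cb`); 03 = §4 THE ENGINE **`thinFibreAt_CB (h₁ h₀ l₁ l₀ : ℤ) (hm : 2 ≤ m₀) : ThinFibreAt m₀ (CB h₁ h₀ l₁ l₀)`** HYPOTHESIS-FREE, uniform over ℤ⁴ (the Runge function on the μ₃-cover is w + 2); 04 = §5 class data (`xDisc`, `CJ j := CB 0 5 5 (10 + 600 j)`, `cjQ`, `cjD`) and §6 the RABIN certificate mod 3 + Gauss: `Irreducible ((xDisc (CJ j)).map ℚ)` uniformly in j; 05 = §7 TERRITORY (section Territory): `CJ_territory`, named members CJ0 / CJ1. PORT EDITS: (a) 33 one-line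 docstrings quoting the signature on the undocumented decls (`cbC_two` / `cbC_one` / `cbC_zero` / `cbC_of_gt`, `aeval_cbH`, `aeval_cbL`, `monic_cbH`, `cbH_ne_zero`, `natDegree_cjD`, `coeff_cjD_six/five/four`, `leadingCoeff_cjD`, `ra2` … `re3`, `natDegree_cbH`, `natDegree_cbC_zero`, `natDegree_cbC_one_055`, `coeff_zero_cbC_two_055`, `monic_cjQ`, `natDegree_cjQ`, `cjQ_ne_zero`, `coeff_four_cjQ`, `cbC_two_055_ne_zero`, `bzB`, `bzM`, `bzW`, `thinFibreAt_two_CJ1`, `CJ0_territory`); (b) PRIVATISATION ×2 of the §0 one-liners that the head dry-run BOUNCED as dedup.landed twins of importable out-of-cone declarations — `isCoprime_num_den_cb` (≡ `Literature.NumberTheory.DiophantineApproximation.isCoprime_num_den`) and `odd_psNumer_cb` (≡ `RootDecomp1KCollarCell.odd_psNumer_two`, CollarCell02 = +53 modules) — with file-local private copies in 03 where §4's `thinFibreAt_CB` uses them; (c) K's import line moved ABOVE its 4-line copyright comment (the part-01 provenance module docstring must follow the import; comment kept verbatim); nothing else (no deletion, no replacement of a statement, no import added, no set_option; K's `@[simp]`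 kept); provenance doc blocks + continuation headers = K's own open-lines; statements and proofs VERBATIM. Rung 0 — nothing here proves Schanuel, 33364, 33363, 31077 or ThinFibre 2; everything HYPOTHESIS-FREE.)
-/

noncomputable section

namespace Summit.Schanuel.Schanuel.Theorems.RootDecomp1KCubicDescent

open Polynomial LiouvilleNumber
open scoped Nat
open Summit.Schanuel.Schanuel.Theorems.RootDecomp1KTwoBaseCell (psNumer partialSum_eq_psNumer_div coprime_psNumer)
open Summit.Schanuel.Schanuel.Theorems.RootDecomp1KDegreeLadder
open Summit.Schanuel.Schanuel.Theorems.RootDecomp1KXLinear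
open Summit.Schanuel.Schanuel.Theorems.RootDecomp1KXLinearII
open Summit.Schanuel.Schanuel.Theorems.RootDecomp1KXTop
open Summit.Schanuel.Schanuel.Theorems.RootDecomp1KXAll
open Summit.Schanuel.Schanuel.Theorems.RootDecomp1KLevelFinite
open Summit.Schanuel.Schanuel.Theorems.RootDecomp1KThueMahler
open Summit.Schanuel.Schanuel.Theorems.RootDecomp1KParamThueMahler
open Summit.Schanuel.Schanuel.Theorems.RootDecomp1KLocalExponent
open Summit.Schanuel.Schanuel.Theorems.RootDecomp1KIntegrality (GaussAt gaussAt_xPolyP_iff)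
open Summit.Schanuel.Schanuel.Theorems.RootDecomp1KSubspaceBranch (SepTopAt)
open Summit.Schanuel.Schanuel.Theorems.RootDecomp1KRunge
open Summit.Schanuel.Schanuel.Theorems.RootDecomp1KDescent

/-! ### §5 Class data: the `x`-discriminant, the sub-family `CJ j = CB(0, 5, 5, 10 + 600j)` -/

/-- [class datum] the `x`-DISCRIMINANT of the `x`-quadratic presentation: `Δ_x(P) := c₁² − 4·c₀·c₂`
(`c_j = xCoeff P j`).  K-R50 (ii): `Δ_x` ℚ-irreducible of degree `≡ 2 (mod 4)` certifies «no ℚ-rational 2-torsion». -/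
def xDisc (P : ℤ[X][X]) : ℤ[X] := xCoeff P 1 ^ 2 - 4 * xCoeff P 0 * xCoeff P 2

/-- `(i : ℕ) : xCoeff (CB h₁ h₀ l₁ l₀) i = cbC h₁ h₀ l₁ l₀ i`. -/
theorem xCoeff_CB (h₁ h₀ l₁ l₀ : ℤ) (i : ℕ) : xCoeff (CB h₁ h₀ l₁ l₀) i = cbC h₁ h₀ l₁ l₀ i := by
  rw [CB, xCoeff_xPolyP]
  split_ifs with h
  · rfl
  · exact (cbC_of_gt _ _ _ _ (by omega)).symm

/-- **the 3-torsion shape of the whole family**: `Δ_x(CB) = G² + 4H³`, `G = L·H + 4`. -/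
theorem xDisc_CB (h₁ h₀ l₁ l₀ : ℤ) :
    xDisc (CB h₁ h₀ l₁ l₀) = (cbL l₁ l₀ * cbH h₁ h₀ + 4) ^ 2 + 4 * cbH h₁ h₀ ^ 3 := by
  rw [xDisc, xCoeff_CB, xCoeff_CB, xCoeff_CB, disc_identity]

/-- [datum] `λ_j := 10 + 600·j` (`600 = 8·3·25` freezes the residues mod `8`, `3`, `25` the certificates read). -/
def cjLam (j : ℕ) : ℤ := 10 + 600 * j

/-- [datum] **the sub-family `CJ j := CB(0, 5, 5, λ_j)`**: `H = Y² + 5`, `L = 5Y + λ_j`. -/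
def CJ (j : ℕ) : ℤ[X][X] := CB 0 5 5 (cjLam j)

/-- [datum] the top `Q_λ = H² + 4L = Y⁴ + 10Y² + 20Y + (25 + 4λ)`. -/
def cjQ (l : ℤ) : ℤ[X] := X ^ 4 + C 10 * X ^ 2 + C 20 * X + C (25 + 4 * l)

/-- `(l : ℤ) : cbC 0 5 5 l 2 = cjQ l`. -/
theorem cbC_two_eq_cjQ (l : ℤ) : cbC 0 5 5 l 2 = cjQ l := by
  simp only [cbC_two, cbH, cbL, cjQ, map_zero, zero_mul, add_zero, map_add, map_mul, map_ofNat]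
  ring

/-- [datum] `Δ_x` of `CB(0,5,5,λ)` EXPANDED (generator `gen59.py`; re-proved by `ring`):
`29Y⁶ + 10λY⁵ + (λ²+310)Y⁴ + (100λ+40)Y³ + (10λ²+8λ+925)Y² + (250λ+200)Y + (25λ²+40λ+516)`. -/
def cjD (l : ℤ) : ℤ[X] :=
  C ((516) + (40) * l + (25) * l ^ 2) + C ((200) + (250) * l) * X + C ((925) + (8) * l + (10) * l ^ 2) * X ^ 2 + C ((40) + (100) * l) * X ^ 3 + C ((310) + (1) * l ^ 2) * X ^ 4 + C ((10) * l) * X ^ 5 + C ((29)) * X ^ 6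

/-- `(l : ℤ) : cbC 0 5 5 l 1 ^ 2 - 4 * cbC 0 5 5 l 0 * cbC 0 5 5 l 2 = cjD l`. -/
theorem disc_eq_cjD (l : ℤ) : cbC 0 5 5 l 1 ^ 2 - 4 * cbC 0 5 5 l 0 * cbC 0 5 5 l 2 = cjD l := by
  simp only [cbC_two, cbC_one, cbC_zero, cbH, cbL, cjD, map_zero, zero_mul, add_zero, map_add, map_mul, map_pow,
    map_ofNat, one_mul]
  ring

/-- `(j : ℕ) : xDisc (CJ j) = cjD (cjLam j)`. -/
theorem xDisc_CJ (j : ℕ) : xDisc (CJ j) = cjD (cjLam j) := by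
  rw [CJ, xDisc, xCoeff_CB, xCoeff_CB, xCoeff_CB, disc_eq_cjD]

/-- `(l : ℤ) : (cjD l).natDegree = 6`. -/
theorem natDegree_cjD (l : ℤ) : (cjD l).natDegree = 6 := by unfold cjD; compute_degree!

/-- `(l : ℤ) : (cjD l).coeff 6 = 29`. -/
theorem coeff_cjD_six (l : ℤ) : (cjD l).coeff 6 = 29 := by
  rw [cjD]; simp only [coeff_add, coeff_C_mul_X_pow, coeff_C_mul_X, coeff_C]; norm_num
/-- `(l : ℤ) : (cjD l).coeff 5 = 10 * l`. -/
theorem coeff_cjD_five (l : ℤ) : (cjD l).coeff 5 = 10 * l := by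
  rw [cjD]; simp only [coeff_add, coeff_C_mul_X_pow, coeff_C_mul_X, coeff_C]; norm_num
/-- `(l : ℤ) : (cjD l).coeff 4 = 310 + l ^ 2`. -/
theorem coeff_cjD_four (l : ℤ) : (cjD l).coeff 4 = 310 + l ^ 2 := by
  rw [cjD]; simp only [coeff_add, coeff_C_mul_X_pow, coeff_C_mul_X, coeff_C]; norm_num
/-- `(l : ℤ) : (cjD l).leadingCoeff = 29`. -/
theorem leadingCoeff_cjD (l : ℤ) : (cjD l).leadingCoeff = 29 := by
  rw [leadingCoeff, natDegree_cjD, coeff_cjD_six]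

/-- `Δ_λ` is PRIMITIVE for every `λ`: its content divides `29 = lc`, and `29 ∣ 10λ, λ² + 310` is impossible. -/
theorem isPrimitive_cjD (l : ℤ) : (cjD l).IsPrimitive := by
  intro r hr
  rw [C_dvd_iff_dvd_coeff] at hr
  have h6 : r ∣ 29 := by have := hr 6; rwa [coeff_cjD_six] at this
  have h5 : r ∣ 10 * l := by have := hr 5; rwa [coeff_cjD_five] at this
  have h4 : r ∣ 310 + l ^ 2 := by have := hr 4; rwa [coeff_cjD_four] at this
  have h29 : r.natAbs ∣ 29 := by
    have : (r.natAbs : ℤ) ∣ 29 := Int.natAbs_dvd.mpr h6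
    exact_mod_cast this
  rcases (Nat.dvd_prime (by norm_num : Nat.Prime 29)).mp h29 with h1 | h1
  · exact Int.isUnit_iff_natAbs_eq.mpr h1
  · exfalso
    have hr29 : (29 : ℤ) ∣ r := by
      have : ((29 : ℕ) : ℤ) ∣ r := Int.natCast_dvd.mpr (by rw [h1])
      exact_mod_cast this
    have hp29 : Prime (29 : ℤ) := Int.prime_iff_natAbs_prime.mpr (by norm_num)
    rcases hp29.dvd_or_dvd (hr29.trans h5) with h10 | hl
    · norm_num at h10
    · obtain ⟨c, hc⟩ := hl
      have h310 : (29 : ℤ) ∣ 310 := by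
        have := dvd_sub (hr29.trans h4) (Dvd.intro (29 * c ^ 2) (by rw [hc]; ring) : (29 : ℤ) ∣ l ^ 2)
        have e : 310 + l ^ 2 - l ^ 2 = 310 := by ring
        rwa [e] at this
      norm_num at h310

/-! ### §6 `Δ_x(CJ j)` is IRREDUCIBLE over `ℚ`: a RABIN certificate mod 3 + GAUSS

The family is CONSTANT mod 3 (`λ ≡ 1`): `Δ ≡ 2Y⁶ + Y⁵ + 2Y⁴ + 2Y³ + Y² + 2 (mod 3)`.  Two integer Bezout identities
(slack `3·E`, explicit, `λ = 1 + 3t`) make `Δ mod 3` coprime to `Y⁹ − Y` and to `Y²⁷ − Y`, hence (every monic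
irreducible of degree `k` over `𝔽₃` divides `Y^{3^k} − Y`) free of factors of degree `1, 2, 3`, hence irreducible of
degree 6; `Δ` is primitive with the same degree mod 3, so irreducible in `ℤ[Y]`, so over `ℚ` (Gauss). -/

/-- `: ℤ[X]`. -/
def ra2 : ℤ[X] :=
  C ((2)) + C ((1)) * X + C ((1)) * X ^ 6 + C ((2)) * X ^ 7 + C ((1)) * X ^ 8

/-- `: ℤ[X]`. -/
def rb2 : ℤ[X] :=
  C ((2)) + C ((2)) * X + C ((2)) * X ^ 2 + C ((1)) * X ^ 4 + C ((1)) * X ^ 5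

/-- `(t : ℤ) : ℤ[X]`. -/
def re2 (t : ℤ) : ℤ[X] :=
  C ((387) + (180) * t + (150) * t ^ 2) + C ((493) + (590) * t + (75) * t ^ 2) * X + C ((778) + (306) * t + (60) * t ^ 2) * X ^ 2 + C ((407) + (228) * t + (30) * t ^ 2) * X ^ 3 + C ((254) + (104) * t + (6) * t ^ 2) * X ^ 4 + C ((110) + (22) * t + (3) * t ^ 2) * X ^ 5 + C ((216) + (100) * t + (75) * t ^ 2) * X ^ 6 + C ((547) + (430) * t + (150) * t ^ 2) * X ^ 7 + C ((808) + (618) * t + (105) * t ^ 2) * X ^ 8 + C ((826) + (406) * t + (60) * t ^ 2) * X ^ 9 + C ((512) + (230) * t + (33) * t ^ 2) * X ^ 10 + C ((258) + (114) * t + (6) * t ^ 2) * X ^ 11 + C ((120) + (22) * t + (3) * t ^ 2) * X ^ 12 + C ((23) + (10) * t) * X ^ 13 + C ((10)) * X ^ 14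

/-- `: ℤ[X]`. -/
def ra3 : ℤ[X] :=
  C ((2)) + C ((2)) * X ^ 3 + C ((1)) * X ^ 7 + C ((2)) * X ^ 8 + C ((2)) * X ^ 9 + C ((1)) * X ^ 10 + C ((2)) * X ^ 11 + C ((1)) * X ^ 12 + C ((1)) * X ^ 14 + C ((2)) * X ^ 15 + C ((1)) * X ^ 16 + C ((1)) * X ^ 19 + C ((1)) * X ^ 22 + C ((2)) * X ^ 23 + C ((2)) * X ^ 24 + C ((2)) * X ^ 26

/-- `: ℤ[X]`. -/
def rb3 : ℤ[X] :=
  C ((2)) * X + C ((2)) * X ^ 2 + C ((1)) * X ^ 3 + C ((1)) * X ^ 4 + C ((2)) * X ^ 5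

/-- `(t : ℤ) : ℤ[X]`. -/
def re3 (t : ℤ) : ℤ[X] :=
  C ((387) + (180) * t + (150) * t ^ 2) + C ((300) + (500) * t) * X + C ((628) + (56) * t + (60) * t ^ 2) * X ^ 2 + C ((480) + (380) * t + (150) * t ^ 2) * X ^ 3 + C ((507) + (504) * t + (6) * t ^ 2) * X ^ 4 + C ((635) + (76) * t + (60) * t ^ 2) * X ^ 5 + C ((112) + (200) * t) * X ^ 6 + C ((401) + (94) * t + (81) * t ^ 2) * X ^ 7 + C ((544) + (450) * t + (150) * t ^ 2) * X ^ 8 + C ((1021) + (708) * t + (180) * t ^ 2) * X ^ 9 + C ((1169) + (746) * t + (135) * t ^ 2) * X ^ 10 + C ((1363) + (688) * t + (213) * t ^ 2) * X ^ 11 + C ((1112) + (832) * t + (111) * t ^ 2) * X ^ 12 + C ((1049) + (430) * t + (66) * t ^ 2) * X ^ 13 + C ((731) + (340) * t + (108) * t ^ 2) * X ^ 14 + C ((814) + (544) * t + (156) * t ^ 2) * X ^ 15 + C ((928) + (640) * t + (108) * t ^ 2) * X ^ 16 + C ((848) + (416) * t + (60) * t ^ 2) * X ^ 17 + C ((521)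 + (230) * t + (33) * t ^ 2) * X ^ 18 + C ((451) + (204) * t + (81) * t ^ 2) * X ^ 19 + C ((270) + (272) * t + (3) * t ^ 2) * X ^ 20 + C ((337) + (38) * t + (30) * t ^ 2) * X ^ 21 + C ((250) + (190) * t + (75) * t ^ 2) * X ^ 22 + C ((641) + (432) * t + (153) * t ^ 2) * X ^ 23 + C ((1005) + (718) * t + (180) * t ^ 2) * X ^ 24 + C ((985) + (656) * t + (60) * t ^ 2) * X ^ 25 + C ((1213) + (438) * t + (213) * t ^ 2) * X ^ 26 + C ((604) + (714) * t + (6) * t ^ 2) * X ^ 27 + C ((853) + (80) * t + (66) * t ^ 2) * X ^ 28 + C ((120) + (220) * t) * X ^ 29 + C ((227) + (4) * t + (6) * t ^ 2) * X ^ 30 + C ((7) + (20) * t) * X ^ 31 + C ((20)) * X ^ 32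

/-- RABIN CERTIFICATE 1: `a₂·Δ_{1+3t} + b₂·(Y⁹ − Y) = 1 + 3·E₂(t)` in `ℤ[Y]`. -/
theorem rabin2 (t : ℤ) : ra2 * cjD (1 + 3 * t) + rb2 * (X ^ 9 - X) = 1 + 3 * re2 t := by
  simp only [ra2, rb2, re2, cjD, map_add, map_mul, map_pow, map_ofNat, map_one, one_mul]
  ring

/-- RABIN CERTIFICATE 2: `a₃·Δ_{1+3t} + b₃·(Y²⁷ − Y) = 1 + 3·E₃(t)` in `ℤ[Y]`. -/
theorem rabin3 (t : ℤ) : ra3 * cjD (1 + 3 * t) + rb3 * (X ^ 27 - X) = 1 + 3 * re3 t := by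
  simp only [ra3, rb3, re3, cjD, map_add, map_mul, map_pow, map_ofNat, map_one, one_mul]
  ring

/-- `3 = 0` in `𝔽₃[Y]`. -/
theorem three_eq_zero_zmod3X : (3 : (ZMod 3)[X]) = 0 := by
  have h : ((3 : ℕ) : (ZMod 3)[X]) = 0 := CharP.cast_eq_zero _ 3
  exact_mod_cast h

/-- `Δ mod 3` is coprime to `Y⁹ − Y` … -/
theorem isCoprime_cjD_map3_nine (t : ℤ) :
    IsCoprime ((cjD (1 + 3 * t)).map (Int.castRingHom (ZMod 3))) (X ^ 9 - X) := by
  have h := congrArg (Polynomial.map (Int.castRingHom (ZMod 3))) (rabin2 t)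
  simp only [Polynomial.map_add, Polynomial.map_mul, Polynomial.map_sub, Polynomial.map_pow, Polynomial.map_X,
    Polynomial.map_one, Polynomial.map_ofNat, three_eq_zero_zmod3X, zero_mul, add_zero] at h
  exact ⟨_, _, h⟩

/-- … and to `Y²⁷ − Y`. -/
theorem isCoprime_cjD_map3_twentyseven (t : ℤ) :
    IsCoprime ((cjD (1 + 3 * t)).map (Int.castRingHom (ZMod 3))) (X ^ 27 - X) := by
  have h := congrArg (Polynomial.map (Int.castRingHom (ZMod 3))) (rabin3 t)
  simp only [Polynomial.map_add, Polynomial.map_mul, Polynomial.map_sub, Polynomial.map_pow, Polynomial.map_X,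
    Polynomial.map_one, Polynomial.map_ofNat, three_eq_zero_zmod3X, zero_mul, add_zero] at h
  exact ⟨_, _, h⟩

/-- `Δ mod 3` has degree 6 (`29 ≢ 0`). -/
theorem natDegree_cjD_map3 (l : ℤ) : ((cjD l).map (Int.castRingHom (ZMod 3))).natDegree = (cjD l).natDegree := by
  refine natDegree_map_of_leadingCoeff_ne_zero _ ?_
  rw [leadingCoeff_cjD]
  decide

/-- RABIN's lemma over `𝔽₃`: a monic irreducible `q` divides `Y^{3^{deg q}} − Y` (its root generates `𝔽_{3^{deg q}}`,
where `a^{3^{deg q}} = a`).  Self-contained (AdjoinRoot + `FiniteField.pow_card`). -/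
theorem dvd_X_pow_sub_X_zmod3 {q : (ZMod 3)[X]} (hq : Irreducible q) (hm : q.Monic) :
    q ∣ (X ^ (3 ^ q.natDegree) - X : (ZMod 3)[X]) := by
  haveI : Fact (Irreducible q) := ⟨hq⟩
  have hq0 : q ≠ 0 := hq.ne_zero
  haveI : Module.Finite (ZMod 3) (AdjoinRoot q) := (AdjoinRoot.powerBasis hq0).finite
  haveI : Finite (AdjoinRoot q) := Module.finite_of_finite (ZMod 3)
  letI : Fintype (AdjoinRoot q) := Fintype.ofFinite _
  have hcard : Fintype.card (AdjoinRoot q) = 3 ^ q.natDegree := by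
    rw [← Nat.card_eq_fintype_card, Module.natCard_eq_pow_finrank (K := ZMod 3), Nat.card_eq_fintype_card,
      ZMod.card, (AdjoinRoot.powerBasis hq0).finrank, AdjoinRoot.powerBasis_dim]
  have hroot : (AdjoinRoot.root q) ^ (3 ^ q.natDegree) = AdjoinRoot.root q := by
    rw [← hcard]; exact FiniteField.pow_card _
  have hmin : minpoly (ZMod 3) (AdjoinRoot.root q) = q := by
    rw [AdjoinRoot.minpoly_root hq0, hm.leadingCoeff, inv_one, map_one, mul_one]
  have h := minpoly.dvd (ZMod 3) (AdjoinRoot.root q) (p := X ^ (3 ^ q.natDegree) - X)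
    (by rw [map_sub, map_pow, aeval_X, hroot, sub_self])
  rwa [hmin] at h

/-- a degree-6 polynomial over `𝔽₃` coprime to `Y⁹ − Y` and `Y²⁷ − Y` is IRREDUCIBLE (no factor of degree `≤ 3`). -/
theorem irreducible_of_coprime_zmod3 {D : (ZMod 3)[X]} (hD : D.natDegree = 6)
    (h9 : IsCoprime D (X ^ 9 - X)) (h27 : IsCoprime D (X ^ 27 - X)) : Irreducible D := by
  have hD0 : D ≠ 0 := by rintro rfl; simp at hD
  -- no monic irreducible factor of degree ≤ 3
  have key : ∀ q : (ZMod 3)[X], Irreducible q → q.Monic → q ∣ D → 3 < q.natDegree := by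
    intro q hq hm hqD
    have hpos := hq.natDegree_pos
    by_contra hle
    have hle' : q.natDegree ≤ 3 := not_lt.mp hle
    have hdvd := dvd_X_pow_sub_X_zmod3 hq hm
    have hW : q ∣ (X ^ 9 - X : (ZMod 3)[X]) ∨ q ∣ (X ^ 27 - X : (ZMod 3)[X]) := by
      interval_cases hdeg : q.natDegree
      · left
        exact hdvd.trans ⟨X ^ 6 + X ^ 4 + X ^ 2 + 1, by ring⟩
      · left; simpa using hdvd
      · right; simpa using hdvd
    rcases hW with h | h
    · exact hq.not_isUnit (h9.isUnit_of_dvd' hqD h)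
    · exact hq.not_isUnit (h27.isUnit_of_dvd' hqD h)
  refine irreducible_iff.mpr ⟨fun hu => ?_, fun a b hab => ?_⟩
  · have := natDegree_eq_zero_of_isUnit hu; omega
  · by_contra hboth
    obtain ⟨hau, hbu⟩ := not_or.mp hboth
    have ha0 : a ≠ 0 := by rintro rfl; rw [zero_mul] at hab; exact hD0 hab
    have hb0 : b ≠ 0 := by rintro rfl; rw [mul_zero] at hab; exact hD0 hab
    have hdeg : a.natDegree + b.natDegree = 6 := by rw [← natDegree_mul ha0 hb0, ← hab, hD]
    rcases le_or_gt a.natDegree 3 with ha3 | ha3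
    · obtain ⟨q, hm, hq, hqa⟩ := exists_monic_irreducible_factor a hau
      have h1 := key q hq hm (hqa.trans (Dvd.intro b hab.symm))
      have h2 := natDegree_le_of_dvd hqa ha0
      omega
    · obtain ⟨q, hm, hq, hqb⟩ := exists_monic_irreducible_factor b hbu
      have h1 := key q hq hm (hqb.trans (Dvd.intro_left a hab.symm))
      have h2 := natDegree_le_of_dvd hqb hb0
      omega

/-- TRANSFER `𝔽₃ → ℤ`: a PRIMITIVE integer polynomial whose reduction mod 3 has the same degree and is irreducible is
irreducible in `ℤ[Y]` (a factor mapping to a unit has degree 0, i.e. is a constant dividing the content). -/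
theorem irreducible_of_irreducible_map3 {D : ℤ[X]} (hprim : D.IsPrimitive)
    (hdeg : (D.map (Int.castRingHom (ZMod 3))).natDegree = D.natDegree)
    (hirr : Irreducible (D.map (Int.castRingHom (ZMod 3)))) : Irreducible D := by
  set f := Int.castRingHom (ZMod 3) with hf
  have hD0 : D ≠ 0 := by rintro rfl; rw [Polynomial.map_zero] at hirr; exact not_irreducible_zero hirr
  have key : ∀ a b : ℤ[X], D = a * b → IsUnit (a.map f) → IsUnit a := by
    intro a b hab hua
    have ha0 : a ≠ 0 := by rintro rfl; rw [zero_mul] at hab; exact hD0 hab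
    have hb0 : b ≠ 0 := by rintro rfl; rw [mul_zero] at hab; exact hD0 hab
    have h1 : (a.map f).natDegree = 0 := natDegree_eq_zero_of_isUnit hua
    have h2 : D.natDegree = a.natDegree + b.natDegree := by rw [hab, natDegree_mul ha0 hb0]
    have h3 : (D.map f).natDegree ≤ (a.map f).natDegree + (b.map f).natDegree := by
      rw [hab, Polynomial.map_mul]; exact natDegree_mul_le
    have h4 : (b.map f).natDegree ≤ b.natDegree := natDegree_map_le
    have ha : a.natDegree = 0 := by omega
    rw [eq_C_of_natDegree_eq_zero ha]
    refine (hprim (a.coeff 0) ?_).map C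
    rw [← eq_C_of_natDegree_eq_zero ha]
    exact Dvd.intro b hab.symm
  refine irreducible_iff.mpr ⟨fun hu => hirr.not_isUnit ?_, fun a b hab => ?_⟩
  · simpa using hu.map (mapRingHom f)
  · have hm : D.map f = a.map f * b.map f := by rw [hab, Polynomial.map_mul]
    rcases (irreducible_iff.mp hirr).2 hm with h | h
    · exact Or.inl (key a b hab h)
    · exact Or.inr (key b a (hab.trans (mul_comm a b)) h)

/-- **`Δ_x(CB(0,5,5,λ))` is IRREDUCIBLE in `ℤ[Y]` for every `λ ≡ 1 (mod 3)`** … -/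
theorem irreducible_cjD (t : ℤ) : Irreducible (cjD (1 + 3 * t)) :=
  irreducible_of_irreducible_map3 (isPrimitive_cjD _) (natDegree_cjD_map3 _)
    (irreducible_of_coprime_zmod3 (by rw [natDegree_cjD_map3, natDegree_cjD])
      (isCoprime_cjD_map3_nine t) (isCoprime_cjD_map3_twentyseven t))

/-- **… hence IRREDUCIBLE OVER `ℚ`** (Gauss: Mathlib `IsPrimitive.Int.irreducible_iff_irreducible_map_cast`). -/
theorem irreducible_cjD_rat (t : ℤ) : Irreducible ((cjD (1 + 3 * t)).map (Int.castRingHom ℚ)) :=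
  (IsPrimitive.Int.irreducible_iff_irreducible_map_cast (isPrimitive_cjD _)).mp (irreducible_cjD t)

/-- `λ_j = 1 + 3·(3 + 200j)`. -/
theorem cjLam_eq (j : ℕ) : cjLam j = 1 + 3 * (3 + 200 * (j : ℤ)) := by rw [cjLam]; ring

/-- **THE K-R50 (ii) CERTIFICATE, TYPED: `Δ_x(CJ j)` is ℚ-irreducible of degree `6 ≡ 2 (mod 4)`** — the
Jacobian of `y² = Δ_x` has NO ℚ-rational 2-torsion; `CJ j` is outside every 2-descent class. -/
theorem irreducible_xDisc_CJ (j : ℕ) :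
    Irreducible ((xDisc (CJ j)).map (Int.castRingHom ℚ)) ∧ (xDisc (CJ j)).natDegree = 6 ∧ (xDisc (CJ j)).natDegree % 4 = 2 := by
  rw [xDisc_CJ, cjLam_eq, natDegree_cjD]
  exact ⟨irreducible_cjD_rat _, rfl, rfl⟩

end Summit.Schanuel.Schanuel.Theorems.RootDecomp1KCubicDescent

end
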